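import Summits.Ventures.HSemireg.WedgeBoxPerQCount
import Summits.Ventures.HSemireg.WedgeBoxAll
import Summits.Ventures.HSemireg.WedgePairRank
import Summits.Ventures.HSemireg.FormulaNUniformKernel

/-!
# Venture HSemireg — the PER-`q` ranks of the box in th-7's wedge model: SHARPNESS of `m ≥ 1` (the degree-0 exception) and the
# OVERLAP SUM `Σ_q rank_q = rank + 2·r_m(n)` as kernel theorems

HONEST FRAMING. Part of the Lean index of the computation cell `pub-hsemireg` (seat p10 gen 2, Sunday typer «UNIFORM-IN-n»).
Finite-dimensional EXTERIOR ALGEBRA over a field and ARITHMETIC ONLY: no variety, no cohomology theory, no sheaf, no semiregularity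
map is constructed here; nothing here says that HC / HC_CM / HC_AV holds; no Literature fact is declared or used.  THEOREMS ONLY.

`WedgeBoxPerQCount.lean` proved th-6's PER-q LAW in the model: `rank(blockProj q ∘ (θ ↦ θ ∧ (f₁ ∧ f₂)) ∣ ⋀^k K^{4n}) =
blockCount n k q = [t^k u^q] Q_n(t,u)²` for every `n ≥ 1`, `k ≥ 1`.  Here:
* §1 **THE HYPOTHESIS `k ≥ 1` IS SHARP** (th-6, FORMULA-N PART A §4.1″: «the only multi-component source vector is θ = 1 ∈ HT⁰
  … (terms with m ≥ 1)»): in degree `0` the block `q = n` of `1 ∧ (f₁ ∧ f₂) = f₁ ∧ f₂` is the SINGLE vector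
  `c₀₁ E_{X ∪ Y′} + c₁₀ E_{Y ∪ X′}` (the two mixed Künneth components `1 ⊗ pt′` and `pt ⊗ 1` of the class), of rank `1`, whereas
  `[t⁰ uⁿ] Q_n(t,u)² = 2` (`blockCount_zero_middle`, `finrank_range_blockProj_wedgeMap_zero_middle`, `perq_law_fails_in_degree_zero`).
* §2 **THE OVERLAP SUM in the model** (red-5's reader caution, STRUCTURE C13 v0.27 «Σ_q block ranks (60 at n = 3) ≠ rank σ (48) —
  the blocks overlap», now a kernel statement uniform in `n` and `k`): for `n ≥ 1`, `1 ≤ k ≤ 2n`,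
      `Σ_{q ≤ 2n} rank(blockProj q ∘ (θ ↦ θ ∧ (f₁ ∧ f₂)) ∣ ⋀^k) = rank(θ ↦ θ ∧ (f₁ ∧ f₂) ∣ ⋀^k) + 2·r_k(n)`
  (`sum_finrank_range_blockProj_eq`), combining the per-q law with th-7's total rank `R_k(n) = boxRank n k`
  (`WedgeBox.finrank_range_wedgeMap_fac_mul_all` via `FormulaN.Uniform.finrank_range_box_eq_boxRank`) and the arithmetic
  `Σ_q [t^k u^q]Q_n² = R_k(n) + 2 r_k(n) + [k = 0]` (`FormulaNUniformBlocks.sum_blockCount`; blocks `q > 2n` are empty,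
  `blockCount_eq_zero_of_lt`).  `48 + 12 = 60` at `n = 3`, `k = 2`.  Also the degree-3 closed form as a rank theorem for `n ≥ 4`
  (`finrank_range_blockProj_three_eq`, from `FormulaNUniformBlocks.blockCount_three`) and the palindrome `rank_q = rank_{2n−k−q}`
  (`finrank_range_blockProj_symm`).
* §2b **th-7 §G's η-WEIGHT blocks ARE th-6's q-blocks** (`kweight_eq`: `w = 2n − k − 2q` for every degree-`(k+2n)` monomial;
  `weightProj_comp_wedgeMap_eq`, `finrank_range_weightProj_wedgeMap`): the weight-`w` block of `θ ↦ θ ∧ (f₁ ∧ f₂)` on `⋀^k` has rank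
  `[t^k u^q]Q_n²` with `q = (2n − k − w)/2` — degree 2: weight `0` ↦ `2n²` («the (1,1)-Künneth cross terms»), `±2` ↦ `n² − n`,
  `±(2n−2)` ↦ `2n² − n` (STRUCTURE C13 ↔ C1's «K-weight pieces», §G).
* §3 **(S2) ⇒ PER-q** (`finrank_range_blockProj_sigma_of_saturation`): with the bridge `σ ∘ ev = (θ ↦ θ ∧ (f₁ ∧ f₂))` and the
  extremal count `dim Ext^k = R_k(n)` as HYPOTHESES BY VALUE (as in `FormulaN.Uniform.model_saturation`, (S2)), `ev` is onto and the
  `q`-blocks of `σ` ITSELF have ranks `blockCount n k q` — the form in which th-6 states the law («rank(σ_q ∣ Ext^m(G_n,G_n))»);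
  the identification of `Ext2` with an Ext group of a sheaf and of `σ` with the Buchweitz–Flenner map stays on paper ([BF08] 6.4.2).
* §4 the FACTOR (th-7's `WedgePair` model): the two image pieces `Tset n k` of `θ ↦ θ ∧ (a E_X + c E_Y)` (`range_eq_span_Tset`, tree)
  have η-weights `±(n − k)` — (S1)'s «pair of K-isotypic pieces of weights ∓(n−k)» (`range_pointPair_isotypic`).
-/

open Module Set Set.powersetCard Finset Polynomial

namespace Summit.Ventures.HSemireg.FormulaN.Uniform

/-! ## Arithmetic: blocks beyond `q = 2n` are empty; the overlap sum over `q ≤ 2n` -/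

/-- the atom has no block beyond `q₁ = n`. -/
theorem qAtom_eq_zero_of_lt {n i q₁ : ℕ} (h : n < q₁) : qAtom n i q₁ = 0 := by
  unfold qAtom
  split_ifs <;> omega

/-- the box has no block beyond `q = 2n`. -/
theorem blockCount_eq_zero_of_lt {n k q : ℕ} (h : n + n < q) : blockCount n k q = 0 := by
  unfold blockCount
  refine Finset.sum_eq_zero fun ij _ => Finset.sum_eq_zero fun pq hpq => ?_
  rw [Finset.HasAntidiagonal.mem_antidiagonal] at hpq
  rcases (show n < pq.1 ∨ n < pq.2 by omega) with h1 | h2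
  · rw [qAtom_eq_zero_of_lt h1, zero_mul]
  · rw [qAtom_eq_zero_of_lt h2, mul_zero]

/-- two truncations of a sum beyond the support agree. -/
theorem sum_range_eq_of_vanishing {f : ℕ → ℤ} {a b : ℕ} (ha : ∀ q, a ≤ q → f q = 0) (hb : ∀ q, b ≤ q → f q = 0) :
    ∑ q ∈ range a, f q = ∑ q ∈ range b, f q := by
  rcases le_total a b with h | h
  · exact Finset.sum_subset (Finset.range_subset_range.mpr h) fun q _ hq => ha q (by
      rw [Finset.mem_range, not_lt] at hq; exact hq)
  · exact (Finset.sum_subset (Finset.range_subset_range.mpr h) fun q _ hq => hb q (by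
      rw [Finset.mem_range, not_lt] at hq; exact hq)).symm

/-- **`Σ_{q ≤ 2n} [t^k u^q] Q_n² = R_k(n) + 2 r_k(n) + [k = 0]`** (the overlap count of `FormulaNUniformBlocks.sum_blockCount` with the
explicit range `q ≤ 2n`). -/
theorem sum_blockCount_range (n k : ℕ) :
    (∑ q ∈ range (n + n + 1), (blockCount n k q : ℤ)) =
      (boxRank n k : ℤ) + 2 * (transversePairRank n k : ℤ) + if k = 0 then 1 else 0 := by
  rw [← sum_blockCount]
  apply sum_range_eq_of_vanishing
  · intro q hq
    exact_mod_cast blockCount_eq_zero_of_lt (by omega)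
  · intro q hq
    rw [← coeff_Q_sq]
    exact Polynomial.coeff_eq_zero_of_natDegree_lt (by omega)

/-- degree `0`, block `q = n`: `[t⁰ uⁿ] Q_n(t,u)² = 2` for `n ≥ 1` (the two products `1 ⊗ pt′` and `pt ⊗ 1`); the other degree-0
blocks are `[q = 0] + [q = 2n]`. -/
theorem blockCount_zero {n : ℕ} (hn : 0 < n) (q : ℕ) :
    blockCount n 0 q = (if q = 0 then 1 else 0) + (if q = n then 2 else 0) + (if q = n + n then 1 else 0) := by
  rw [blockCount, Finset.Nat.antidiagonal_zero, Finset.sum_singleton]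
  simp only [sum_antidiagonal_qAtom, Nat.choose_zero_right, hn, true_and, Nat.sub_zero, mul_one]
  split_ifs <;> omega

/-- in particular `[t⁰ uⁿ] Q_n² = 2` (`n ≥ 1`). -/
theorem blockCount_zero_middle {n : ℕ} (hn : 0 < n) : blockCount n 0 n = 2 := by
  rw [blockCount_zero hn, if_neg (by omega : n ≠ 0), if_pos rfl, if_neg (by omega : n ≠ n + n)]

/-- C13 in degree 2 with NO restriction on `n`: `[t² u^q] Q_n² = sigmaBlockRank n q` for ALL `n, q` (`n ≥ 3`: `blockCount_two_eq_
sigmaBlockRank`; `n ≤ 2`: the if-chain's collisions happen to give the right numbers `(1)`, `(6,8,6)`, checked by `decide`, zeros beyond). -/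
theorem blockCount_two_eq_sigmaBlockRank_all (n q : ℕ) : blockCount n 2 q = sigmaBlockRank n q := by
  rcases Nat.lt_or_ge n 3 with hn | hn
  · rcases Nat.lt_or_ge q 7 with hq | hq
    · interval_cases n <;> interval_cases q <;> decide
    · rw [blockCount_eq_zero_of_lt (by omega : n + n < q), sigmaBlockRank]
      split_ifs <;> omega
  · exact blockCount_two_eq_sigmaBlockRank hn q

end Summit.Ventures.HSemireg.FormulaN.Uniform

namespace Summit.Ventures.HSemireg.WedgeBox

open Summit.Ventures.HSemireg.FormulaN.Uniform (qAtom blockCount)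
open Summit.Ventures.HSemireg.FormulaN (transversePairRank)

variable (K : Type*) [Field K] {n : ℕ}

/-! ## §1. The degree-0 exception: the per-q law needs `k ≥ 1` -/

/-- the block of the four class monomials: `qdeg (Aα ∪ Cβ) = [α = 1]·n + [β = 1]·n`. -/
lemma qdeg_P (α β : Fin 2) : qdeg n (P n α β) = (if α = 0 then 0 else n) + (if β = 0 then 0 else n) := by
  have h := qdeg_union_P (n := n) ∅ α β
  rwa [Finset.empty_union, Finset.sdiff_empty, Finset.sdiff_empty, card_A, card_C] at h

/-- the four blocks: `qdeg (X ∪ X′) = 0`, `qdeg (X ∪ Y′) = qdeg (Y ∪ X′) = n`, `qdeg (Y ∪ Y′) = 2n`. -/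
lemma qdeg_P_values :
    qdeg n (P n 0 0) = 0 ∧ qdeg n (P n 0 1) = n ∧ qdeg n (P n 1 0) = n ∧ qdeg n (P n 1 1) = n + n := by
  refine ⟨?_, ?_, ?_, ?_⟩ <;> rw [qdeg_P] <;> simp

/-- in degree `0` the range of `θ ↦ θ ∧ v` is the line through `v`. -/
lemma range_wedgeMap_zero (v : HT K n) : LinearMap.range (wedgeMap K n 0 v) = Submodule.span K {v} := by
  rw [range_wedgeMap]
  congr 1
  ext w
  constructor
  · rintro ⟨s, rfl⟩
    have hs : (s : Finset (I n)) = ∅ := Finset.card_eq_zero.mp (card_eq s)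
    rw [Set.mem_singleton_iff]
    show B K n (s : Finset (I n)) * v = v
    rw [hs, B_empty, one_mul]
  · intro hw
    rw [Set.mem_singleton_iff] at hw
    subst hw
    refine ⟨⟨∅, by rw [mem_iff, Finset.card_empty]⟩, ?_⟩
    show B K n (∅ : Finset (I n)) * w = w
    rw [B_empty, one_mul]

/-- the block `q = n` of the box class itself: the single vector `c₀₁ E_{X ∪ Y′} + c₁₀ E_{Y ∪ X′}` (`n ≥ 1`). -/
lemma blockProj_middle_boxClass (hn : 0 < n) (c : Fin 2 → Fin 2 → K) :
    blockProj K n n (boxClass K n c) =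
      c 0 1 • B K n (P n 0 1) + c 1 0 • B K n (P n 1 0) := by
  obtain ⟨h00, h01, h10, h11⟩ := qdeg_P_values (n := n)
  rw [boxClass]
  simp only [Fin.sum_univ_two, map_add, map_smul, coe_Ppc, blockProj_B, h00, h01, h10, h11, if_true]
  rw [if_neg (by omega : (0 : ℕ) ≠ n), if_neg (by omega : n + n ≠ n), smul_zero, smul_zero, zero_add, add_zero]

/-- that vector is non-zero when `c₀₁ ≠ 0`. -/
lemma blockProj_middle_boxClass_ne_zero (hn : 0 < n) {c : Fin 2 → Fin 2 → K} (hc : c 0 1 ≠ 0) :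
    blockProj K n n (boxClass K n c) ≠ 0 := by
  classical
  intro h
  have h' := congrArg ((B K n).coord (P n 0 1)) h
  rw [blockProj_middle_boxClass K hn, map_add, map_smul, map_smul, Basis.coord_apply, Basis.coord_apply,
    Basis.repr_self, Basis.repr_self, Finsupp.single_eq_same, Finsupp.single_eq_of_ne, map_zero, smul_eq_mul,
    mul_one, smul_zero, add_zero] at h'
  · exact hc h'
  · intro e
    exact absurd (P_injective hn e).1 (by decide)

/-- **degree 0, block `q = n`: rank ONE** — the range of `blockProj n ∘ (θ ↦ θ ∧ box)` on `⋀⁰ = K·1` is the line through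
`c₀₁ E_{X ∪ Y′} + c₁₀ E_{Y ∪ X′}`. -/
theorem finrank_range_blockProj_wedgeMap_zero_middle (hn : 0 < n) {c : Fin 2 → Fin 2 → K} (hc : c 0 1 ≠ 0) :
    finrank K (LinearMap.range (blockProj K n n ∘ₗ wedgeMap K n 0 (boxClass K n c))) = 1 := by
  rw [LinearMap.range_comp, range_wedgeMap_zero, Submodule.map_span, Set.image_singleton,
    finrank_span_singleton (blockProj_middle_boxClass_ne_zero K hn hc)]

/-- **THE PER-q LAW FAILS IN DEGREE 0** (th-6's «terms with m ≥ 1» is sharp): for the honest box on `⋀⁰ K^{4n}`, `n ≥ 1`, the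
block `q = n` has rank `1` while `[t⁰ uⁿ] Q_n(t,u)² = 2` — the source vector `θ = 1` carries two `q`-components in one block. -/
theorem perq_law_fails_in_degree_zero (hn : 0 < n) {a a' : Fin 2 → K} (ha : ∀ α, a α ≠ 0) (ha' : ∀ β, a' β ≠ 0) :
    finrank K (LinearMap.range (blockProj K n n ∘ₗ wedgeMap K n 0 (fac1 K n a * fac2 K n a'))) = 1 ∧
      blockCount n 0 n = 2 := by
  rw [fac1_mul_fac2]
  exact ⟨finrank_range_blockProj_wedgeMap_zero_middle K hn (boxCoeff_ne_zero K ha ha' 0 1),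
    FormulaN.Uniform.blockCount_zero_middle hn⟩

/-! ## §2. The overlap sum in the model -/

/-- **OVERLAP SUM** (uniform in `n` and `k`): for `n ≥ 1`, `1 ≤ k ≤ 2n` and factor coefficients with non-zero entries, the block
ranks of `θ ↦ θ ∧ (f₁ ∧ f₂)` on `⋀^k K^{4n}` over `q = 0, …, 2n` sum to the TOTAL rank plus `2·r_k(n)` (`r_k(n) = [t^k]P_n`, th-6's
`transversePairRank`): the blocks are not independent — e.g. `60 = 48 + 12` at `n = 3`, `k = 2` (red-5, STRUCTURE C13 v0.27). -/
theorem sum_finrank_range_blockProj_eq (hn : 0 < n) {k : ℕ} (hk : 0 < k) (hk2 : k ≤ n + n) {a a' : Fin 2 → K}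
    (ha : ∀ α, a α ≠ 0) (ha' : ∀ β, a' β ≠ 0) :
    ∑ q ∈ range (n + n + 1), finrank K (LinearMap.range (blockProj K n q ∘ₗ wedgeMap K n k (fac1 K n a * fac2 K n a'))) =
      finrank K (LinearMap.range (wedgeMap K n k (fac1 K n a * fac2 K n a'))) + 2 * transversePairRank n k := by
  rw [FormulaN.Uniform.finrank_range_box_eq_boxRank K hn hk2 ha ha',
    Finset.sum_congr rfl fun q _ => finrank_range_blockProj_wedgeMap_fac_mul K hn hk ha ha' q]
  have h := FormulaN.Uniform.sum_blockCount_range n k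
  rw [if_neg (by omega : k ≠ 0), add_zero] at h
  exact_mod_cast h

/-- **degree 2 for EVERY `n ≥ 1`** (C13 as a rank theorem with no `n ≥ 3` guard; `WedgeBoxPerQCount` has the `n ≥ 3` form). -/
theorem finrank_range_blockProj_two_eq_sigmaBlockRank_all (hn : 0 < n) {a a' : Fin 2 → K} (ha : ∀ α, a α ≠ 0)
    (ha' : ∀ β, a' β ≠ 0) (q : ℕ) :
    finrank K (LinearMap.range (blockProj K n q ∘ₗ wedgeMap K n 2 (fac1 K n a * fac2 K n a'))) =
      FormulaN.Uniform.sigmaBlockRank n q := by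
  rw [finrank_range_blockProj_wedgeMap_fac_mul K hn (by omega) ha ha', FormulaN.Uniform.blockCount_two_eq_sigmaBlockRank_all]

/-- **degree 3, uniformly in `n ≥ 4`** (th-6 §4.1″'s third closed form as a RANK theorem): the block ranks of
`θ ↦ θ ∧ (f₁ ∧ f₂)` on `⋀³ K^{4n}` are `C(2n,3)` at `q ∈ {0, 2n−3}`, `2C(n,3)` at `q ∈ {n−3, n}`, `2n·C(n,2) = n²(n−1)` at
`q ∈ {n−2, n−1}`, `0` elsewhere (`FormulaNUniformBlocks.blockCount_three`). -/
theorem finrank_range_blockProj_three_eq (hn : 4 ≤ n) {a a' : Fin 2 → K} (ha : ∀ α, a α ≠ 0) (ha' : ∀ β, a' β ≠ 0) (q : ℕ) :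
    finrank K (LinearMap.range (blockProj K n q ∘ₗ wedgeMap K n 3 (fac1 K n a * fac2 K n a'))) =
      if q = 0 ∨ q = n + n - 3 then (n + n).choose 3
      else if q = n - 3 ∨ q = n then 2 * n.choose 3
      else if q = n - 2 ∨ q = n - 1 then 2 * (n * n.choose 2)
      else 0 := by
  rw [finrank_range_blockProj_wedgeMap_fac_mul K (by omega) (by omega) ha ha', FormulaN.Uniform.blockCount_three hn]

/-- **Serre-type palindrome of the block ranks** in the model: for `n ≥ 1`, `1 ≤ k ≤ 2n`, `q ≤ 2n − k`, the blocks `q` and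
`2n − k − q` of `θ ↦ θ ∧ (f₁ ∧ f₂)` on `⋀^k K^{4n}` have the same rank (`FormulaNUniformBlocks.blockCount_symm`; the swap
`X ↔ Y`, `X′ ↔ Y′` — which block of a factor is called «local» does not matter). -/
theorem finrank_range_blockProj_symm (hn : 0 < n) {k : ℕ} (hk : 0 < k) (hk2 : k ≤ n + n) {q : ℕ} (hq : q ≤ n + n - k)
    {a a' : Fin 2 → K} (ha : ∀ α, a α ≠ 0) (ha' : ∀ β, a' β ≠ 0) :
    finrank K (LinearMap.range (blockProj K n (n + n - k - q) ∘ₗ wedgeMap K n k (fac1 K n a * fac2 K n a'))) =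
      finrank K (LinearMap.range (blockProj K n q ∘ₗ wedgeMap K n k (fac1 K n a * fac2 K n a'))) := by
  rw [finrank_range_blockProj_wedgeMap_fac_mul K hn hk ha ha', finrank_range_blockProj_wedgeMap_fac_mul K hn hk ha ha',
    FormulaN.Uniform.blockCount_symm hk2 hq]

/-- the instance of record: at `n = 3`, `k = 2` the block ranks `(15, 6, 18, 6, 15, 0, 0)` sum to `60 = 48 + 12`. -/
theorem sum_finrank_range_blockProj_three_two {a a' : Fin 2 → K} (ha : ∀ α, a α ≠ 0) (ha' : ∀ β, a' β ≠ 0) :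
    ∑ q ∈ range 7, finrank K (LinearMap.range (blockProj K 3 q ∘ₗ wedgeMap K 3 2 (fac1 K 3 a * fac2 K 3 a'))) = 60 ∧
      finrank K (LinearMap.range (wedgeMap K 3 2 (fac1 K 3 a * fac2 K 3 a'))) = 48 ∧ transversePairRank 3 2 = 6 := by
  refine ⟨?_, ?_, by decide⟩
  · rw [Finset.sum_congr rfl fun q _ => finrank_range_blockProj_wedgeMap_fac_mul K (by omega) (by omega) ha ha' q]
    decide
  · rw [FormulaN.Uniform.finrank_range_box_eq_boxRank K (by omega) (by omega) ha ha']
    decide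

/-! ## §2b. th-7's η-WEIGHT blocks are the same blocks: `w = 2n − k − 2q` -/

/-- the LETTER-COUNT WEIGHT of a monomial `E_T`: `#(X ∪ X′-letters) − #(Y ∪ Y′-letters)` (th-7 PART B §G's η-weight in the
model: `+1` on the `X, X′` letters, `−1` on `Y, Y′`, so that `E_{X ∪ X′}`, `E_{Y ∪ Y′}` have weights `±2n` like `w_±`; quoted, not asserted). -/
def kweight (n : ℕ) (T : Finset (I n)) : ℤ := ((T ∩ P n 0 0).card : ℤ) - ((T ∩ P n 1 1).card : ℤ)

/-- `P 0 0 = X ∪ X′` and `P 1 1 = Y ∪ Y′` partition the generators. -/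
lemma card_inter_P00_add_card_inter_P11 (T : Finset (I n)) : (T ∩ P n 0 0).card + (T ∩ P n 1 1).card = T.card := by
  have hd : Disjoint (T ∩ P n 0 0) (T ∩ P n 1 1) := by
    refine Disjoint.mono Finset.inter_subset_right Finset.inter_subset_right ?_
    rw [P, P, Finset.disjoint_union_left, Finset.disjoint_union_right, Finset.disjoint_union_right]
    exact ⟨⟨disjoint_A_A n (by decide), disjoint_A_C n 0 1⟩, (disjoint_A_C n 1 0).symm, disjoint_C_C n (by decide)⟩
  rw [← Finset.card_union_of_disjoint hd, ← Finset.inter_union_distrib_left]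
  congr 1
  refine Finset.inter_eq_left.mpr fun i _ => ?_
  rw [Finset.mem_union, P, P, Finset.mem_union, Finset.mem_union]
  rcases mem_cover n i with ⟨α, h⟩ | ⟨β, h⟩
  · have : α = 0 ∨ α = 1 := by omega
    rcases this with rfl | rfl
    · exact Or.inl (Or.inl h)
    · exact Or.inr (Or.inl h)
  · have : β = 0 ∨ β = 1 := by omega
    rcases this with rfl | rfl
    · exact Or.inl (Or.inr h)
    · exact Or.inr (Or.inr h)

/-- `#(X ∪ X′-letters of T) = 2n − qdeg T`. -/
lemma card_inter_P00 (T : Finset (I n)) : (T ∩ P n 0 0).card + qdeg n T = n + n := by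
  have h := Finset.card_inter_add_card_sdiff (P n 0 0) T
  rw [card_P] at h
  rw [qdeg, Finset.inter_comm]
  exact h

/-- **the two gradings of record index the same blocks**: for a target monomial of the degree-`k` map (`|T| = k + 2n`),
`kweight T = 2n − k − 2·qdeg T` — th-7 §G's η-weight `w` and th-6's Dolbeault index `q` are affinely related, `w = 2n − k − 2q`
(degree 2: `q = n − 1 ↔ w = 0`, the `2n²` block; `q ∈ {0, 2n−2} ↔ w = ±(2n−2)`; `q ∈ {n−2, n} ↔ w = ±2` — §G's list). -/
theorem kweight_eq {k : ℕ} {T : Finset (I n)} (hT : T.card = k + (n + n)) :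
    kweight n T = (n + n : ℤ) - k - 2 * (qdeg n T : ℤ) := by
  have h1 := card_inter_P00_add_card_inter_P11 (n := n) T
  have h2 := card_inter_P00 (n := n) T
  unfold kweight
  omega

/-- the projection onto the η-weight-`w` monomials of total degree `k + 2n`. -/
noncomputable def weightProj (n k : ℕ) (w : ℤ) : HT K n →ₗ[K] HT K n :=
  (B K n).constr K fun T => if T.card = k + (n + n) ∧ kweight n T = w then B K n T else 0

/-- on the image of the degree-`k` map the weight-`w` projection IS the block projection `q` with `w = 2n − k − 2q`. -/
theorem weightProj_comp_wedgeMap_eq (k q : ℕ) (c : Fin 2 → Fin 2 → K) :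
    weightProj K n k ((n + n : ℤ) - k - 2 * q) ∘ₗ wedgeMap K n k (boxClass K n c) =
      blockProj K n q ∘ₗ wedgeMap K n k (boxClass K n c) := by
  classical
  apply LinearMap.ext
  intro x
  -- reduce to monomials `E_s`, `|s| = k`
  have hx : (x : HT K n) ∈ Submodule.span K (Set.range fun s : powersetCard (I n) k => (B K n s : HT K n)) := by
    rw [← exteriorPower_eq_span]; exact x.2
  rw [LinearMap.comp_apply, LinearMap.comp_apply, wedgeMap_apply]
  refine Submodule.span_induction (p := fun y _ => weightProj K n k ((n + n : ℤ) - k - 2 * q) (y * boxClass K n c) =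
      blockProj K n q (y * boxClass K n c)) ?_ (by simp) (fun y z _ _ hy hz => by rw [add_mul, map_add, map_add, hy, hz])
    (fun r y _ hy => by rw [smul_mul_assoc, map_smul, map_smul, hy]) hx
  rintro _ ⟨s, rfl⟩
  rw [B_mul_boxClass, map_sum, map_sum]
  refine Finset.sum_congr rfl fun α _ => ?_
  rw [map_sum, map_sum]
  refine Finset.sum_congr rfl fun β _ => ?_
  rw [map_smul, map_smul, blockProj_B, weightProj, Basis.constr_basis]
  by_cases hd : Disjoint s.val (P n α β)
  · have hcard : (s.val ∪ P n α β).card = k + (n + n) := by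
      rw [Finset.card_union_of_disjoint hd, card_eq s, card_P]
    rw [kweight_eq hcard]
    by_cases hq : qdeg n (s.val ∪ P n α β) = q
    · rw [if_pos ⟨hcard, by rw [hq]⟩, if_pos hq]
    · rw [if_neg (fun h => hq (by have := h.2; omega)), if_neg hq]
  · rw [sgn_of_not_disjoint K hd, mul_zero, zero_smul, zero_smul]

/-- **th-7 §G's η-weight multiplicities = th-6's per-q law**: for `n ≥ 1`, `k ≥ 1`, every `q` and the honest box, the η-weight
block `w = 2n − k − 2q` of `θ ↦ θ ∧ (f₁ ∧ f₂)` on `⋀^k K^{4n}` has rank `blockCount n k q = [t^k u^q] Q_n²` (degree 2: weight `0` ↦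
`2n²`, weights `±2` ↦ `n² − n`, weights `±(2n−2)` ↦ `2n² − n`, §G / STRUCTURE C1's «K-weight pieces»). -/
theorem finrank_range_weightProj_wedgeMap (hn : 0 < n) {k : ℕ} (hk : 0 < k) {a a' : Fin 2 → K}
    (ha : ∀ α, a α ≠ 0) (ha' : ∀ β, a' β ≠ 0) (q : ℕ) :
    finrank K (LinearMap.range (weightProj K n k ((n + n : ℤ) - k - 2 * q) ∘ₗ wedgeMap K n k (fac1 K n a * fac2 K n a'))) =
      blockCount n k q := by
  rw [fac1_mul_fac2, weightProj_comp_wedgeMap_eq, ← fac1_mul_fac2]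
  exact finrank_range_blockProj_wedgeMap_fac_mul K hn hk ha ha' q

/-! ## §3. Under saturation the block ranks OF `σ` are these numbers ((S2) ⇒ per-q, inputs by value) -/

section Saturation

variable {Ext2 : Type*} [AddCommGroup Ext2] [Module K Ext2] [FiniteDimensional K Ext2]

omit [FiniteDimensional K Ext2] in
/-- bridge + `ev` onto ⇒ every block of `σ` has the range of the corresponding block of the class-side map:
`range(π ∘ σ) = range(π ∘ c)` for `σ ∘ ev = c`, `ev` surjective (pure linear algebra; `π` any endomorphism of the target). -/
theorem range_comp_eq_of_bridge_of_surjective {HT2 Tgt : Type*} [AddCommGroup HT2] [Module K HT2] [AddCommGroup Tgt]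
    [Module K Tgt] (ev : HT2 →ₗ[K] Ext2) (σ : Ext2 →ₗ[K] Tgt) (c : HT2 →ₗ[K] Tgt) (bridge : σ ∘ₗ ev = c)
    (hev : Function.Surjective ev) (π : Tgt →ₗ[K] Tgt) :
    LinearMap.range (π ∘ₗ σ) = LinearMap.range (π ∘ₗ c) := by
  rw [← bridge, ← LinearMap.comp_assoc, LinearMap.range_comp_of_range_eq_top _ (LinearMap.range_eq_top.mpr hev)]

/-- **(S2) ⇒ PER-q, in the model** (STRUCTURE (S2) «δ_E = 0 ⇒ σ_E injective in EVERY degree (saturation: ev onto)» combined with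
th-6's per-q law; the bridge `σ ∘ ev = (θ ↦ θ ∧ (f₁ ∧ f₂))` and the EXTREMAL count `dim Ext^k = R_k(n)` are HYPOTHESES BY VALUE, as in
`FormulaN.Uniform.model_saturation`): for ANY finite-dimensional `Ext2`, `ev : ⋀^k K^{4n} → Ext2`, `σ : Ext2 → ⋀ K^{4n}` with
`σ ∘ ev = (θ ↦ θ ∧ (f₁ ∧ f₂))` and `dim Ext2 = R_k(n)` (`n ≥ 1`, `1 ≤ k ≤ 2n`), the `q`-block of `σ` ITSELF has rank
`blockCount n k q = [t^k u^q] Q_n(t,u)²` for every `q`.  Nothing here identifies `Ext2` with an Ext group of a sheaf. -/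
theorem finrank_range_blockProj_sigma_of_saturation (hn : 0 < n) {k : ℕ} (hk : 0 < k) (hk2 : k ≤ n + n)
    {a a' : Fin 2 → K} (ha : ∀ α, a α ≠ 0) (ha' : ∀ β, a' β ≠ 0)
    (ev : (⋀[K]^k (N K n)) →ₗ[K] Ext2) (σ : Ext2 →ₗ[K] HT K n)
    (bridge : σ ∘ₗ ev = wedgeMap K n k (fac1 K n a * fac2 K n a'))
    (hExt : finrank K Ext2 = FormulaN.Uniform.boxRank n k) (q : ℕ) :
    finrank K (LinearMap.range (blockProj K n q ∘ₗ σ)) = blockCount n k q := by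
  obtain ⟨hsurj, -, -, -⟩ := FormulaN.Uniform.model_saturation K hn hk2 ha ha' ev σ bridge hExt
  rw [range_comp_eq_of_bridge_of_surjective K ev σ _ bridge hsurj,
    finrank_range_blockProj_wedgeMap_fac_mul K hn hk ha ha']

end Saturation

end Summit.Ventures.HSemireg.WedgeBox

/-! ## §4. The factor: th-7's two image pieces `Tset` have η-weights `±(n − k)` ((S1)'s «K-isotypic pieces of weights ∓(n−k)») -/

namespace Summit.Ventures.HSemireg.WedgePair

variable (K : Type*) [Field K] {n k : ℕ}

/-- the letter-count (η-)weight of a monomial of the ONE-FACTOR model `⋀ K^{2n}` of `WedgePair.lean`: `#X-letters − #Y-letters`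
(th-7 PART B §A.3 / §G: `+1` on the block `X`, `−1` on `Y`, so that `E_X`, `E_Y` — the two pure spinors — have weights `±n`; quoted). -/
def etaWeight (n : ℕ) (T : Finset (I n)) : ℤ := ((T ∩ Xset n).card : ℤ) - ((T ∩ Yset n).card : ℤ)

/-- the GLOBAL piece `E_{s ∪ X}` (`s ⊆ Y`, `|s| = k`) has weight `n − k`. -/
lemma etaWeight_union_X {s : Finset (I n)} (hs : s ⊆ Yset n) (hc : s.card = k) :
    etaWeight n (s ∪ Xset n) = (n : ℤ) - k := by
  unfold etaWeight
  rw [Finset.union_inter_cancel_right, card_Xset, Finset.union_inter_distrib_right, Finset.inter_eq_left.mpr hs,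
    Finset.disjoint_iff_inter_eq_empty.mp (disjoint_XY n), Finset.union_empty, hc]

/-- the LOCAL piece `E_{s ∪ Y}` (`s ⊆ X`, `|s| = k`) has weight `k − n`. -/
lemma etaWeight_union_Y {s : Finset (I n)} (hs : s ⊆ Xset n) (hc : s.card = k) :
    etaWeight n (s ∪ Yset n) = (k : ℤ) - n := by
  unfold etaWeight
  rw [Finset.union_inter_cancel_right, card_Yset, Finset.union_inter_distrib_right, Finset.inter_eq_left.mpr hs,
    Finset.disjoint_iff_inter_eq_empty.mp (disjoint_XY n).symm, Finset.union_empty, hc]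

/-- **(S1), factor, «the image of ⌟ch(F) on HT^k(X) is the pair of K-isotypic pieces of weights ∓(n−k)»** in th-7's one-factor
model (STRUCTURE §2 (S1) l.171–172; th-7 Σ1 / PART B §A.3): for `0 < k < n` and `a, c ≠ 0` the range of `θ ↦ θ ∧ (a E_X + c E_Y)`
on `⋀^k K^{2n}` is the span of th-7's monomial set `Tset n k` (`WedgePair.range_eq_span_Tset`, in the tree), and EVERY monomial of
`Tset n k` has η-weight `n − k` (global piece) or `k − n` (local piece). -/
theorem range_pointPair_isotypic (hk0 : 0 < k) {a c : K} (ha : a ≠ 0) (hc : c ≠ 0) :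
    LinearMap.range (wedgeMap K n k (pointPair K n a c)) =
        Submodule.span K (Set.range fun t : (Tset n k : Set (Finset (I n))) => B K n (t : Finset (I n))) ∧
      ∀ T ∈ Tset n k, etaWeight n T = (n : ℤ) - k ∨ etaWeight n T = (k : ℤ) - n := by
  refine ⟨range_eq_span_Tset K hk0 ha hc, fun T hT => ?_⟩
  rw [Tset, Finset.mem_union, Finset.mem_image, Finset.mem_image] at hT
  rcases hT with ⟨s, hs, rfl⟩ | ⟨s, hs, rfl⟩
  · rw [Finset.mem_powersetCard] at hs
    exact Or.inl (etaWeight_union_X hs.1 hs.2)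
  · rw [Finset.mem_powersetCard] at hs
    exact Or.inr (etaWeight_union_Y hs.1 hs.2)

end Summit.Ventures.HSemireg.WedgePair
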